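import Mathlib
import HarnessLib

/-!
# The `2d`-point rule of precision 3 for the hypercube (Davis–Rabinowitz 1984, Sect. 5.7 (5.7.5)–(5.7.8))

Davis–Rabinowitz, *Methods of Numerical Integration* (2nd ed., 1984), Sect. 5.7 "Monomial rules", §1: on the
hypercube `H_d = [-1, 1]^d` the rule
`∫_{H_d} f dV ≈ w Σ f(±u, 0, …, 0)` (sum over the `2d` points `±u e_i`) (5.7.5)
with `w = 2^{d-1}/d` (5.7.6)–(5.7.7) and `u = (d/3)^{1/2}` (5.7.8) is exact for all monomials of degree `≤ 3`
and not for `x_1^4` — a rule of precision exactly `3`; for `d > 3`, `u > 1` and the points lie outside `H_d`.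

Recorded: the monomial moments of the cube `∫_{H_d} x^e dV = ∏_i m(e_i)`, `m(k) = (1 + (-1)^k)/(k+1)`
(Fubini), the rule `hypercubeRule3 d u`, its exactness on every monomial `x^e` with `|e| ≤ 3` whenever
`u² = d/3` (and on their finite linear combinations), the defect `∫ x_1^4 - rule(x_1^4) = 2^d (1/5 - d/9) ≠ 0`,
and `u = √(d/3) > 1 ↔ d > 3`.

Provenance: engines group, shared numerical engines serving client cells; rigour lives in the verifiers; every
published number belongs to a client cell's ledger, not to the engines group.  Textbook facts only (no client
numbers).
-/

namespace Literature.Analysis.Quadrature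

open Set MeasureTheory Finset
open scoped Real

noncomputable section

variable {d : ℕ}

/-- The hypercube `H_d = [-1, 1]^d`. [cite: DavisRabinowitz1984, Sect. 5.7 (5.7.5)] -/
def hypercube (d : ℕ) : Set (Fin d → ℝ) := Set.univ.pi fun _ => Icc (-1 : ℝ) 1

/-- The one-dimensional moments `m(k) = ∫_{-1}^{1} y^k dy = (1 + (-1)^k)/(k+1)`.
[cite: DavisRabinowitz1984, Sect. 5.7 (5.7.8)] -/
def cubeMoment (k : ℕ) : ℝ := (1 + (-1 : ℝ) ^ k) / (k + 1)

/-- `m(0) = 2`, `m(1) = 0`, `m(2) = 2/3`, `m(3) = 0`, `m(4) = 2/5`. [cite: DavisRabinowitz1984, Sect. 5.7 (5.7.8)] -/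
theorem cubeMoment_values : cubeMoment 0 = 2 ∧ cubeMoment 1 = 0 ∧ cubeMoment 2 = 2 / 3 ∧
    cubeMoment 3 = 0 ∧ cubeMoment 4 = 2 / 5 := by
  refine ⟨?_, ?_, ?_, ?_, ?_⟩ <;> norm_num [cubeMoment]

/-- `∫_{[-1,1]} y^k dy = m(k)`. [cite: DavisRabinowitz1984, Sect. 5.7 (5.7.8)] -/
theorem setIntegral_Icc_pow_eq_cubeMoment (k : ℕ) : ∫ y in Icc (-1 : ℝ) 1, y ^ k = cubeMoment k := by
  rw [integral_Icc_eq_integral_Ioc, ← intervalIntegral.integral_of_le (by norm_num), integral_pow,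
    cubeMoment]
  ring

/-- Fubini: `∫_{H_d} x^e dV = ∏_i m(e_i)`. [cite: DavisRabinowitz1984, Sect. 5.7 (5.7.8)] -/
theorem integral_hypercube_monomial (e : Fin d → ℕ) :
    ∫ x in hypercube d, ∏ i, x i ^ e i = ∏ i, cubeMoment (e i) := by
  rw [hypercube, volume_pi, Measure.restrict_pi_pi,
    integral_fintype_prod_eq_prod (fun i (y : ℝ) => y ^ e i)]
  exact Finset.prod_congr rfl fun i _ => setIntegral_Icc_pow_eq_cubeMoment (e i)

/-- `vol H_d = 2^d` (5.7.6). [cite: DavisRabinowitz1984, Sect. 5.7 (5.7.6)] -/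
theorem integral_hypercube_one : ∫ _x in hypercube d, (1 : ℝ) = 2 ^ d := by
  have h := integral_hypercube_monomial (d := d) 0
  simp only [Pi.zero_apply, pow_zero, Finset.prod_const_one, cubeMoment, Nat.cast_zero, zero_add,
    div_one, Finset.prod_const, Finset.card_univ, Fintype.card_fin] at h
  rw [h]
  norm_num

/-- The `2d`-point rule (5.7.5) with weight `w = 2^{d-1}/d` (5.7.7) and node parameter `u`:
`w Σ_i [f(u e_i) + f(-u e_i)]`. [cite: DavisRabinowitz1984, Sect. 5.7 (5.7.5)-(5.7.7)] -/
def hypercubeRule3 (d : ℕ) (u : ℝ) (f : (Fin d → ℝ) → ℝ) : ℝ :=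
  2 ^ (d - 1) / d * ∑ i : Fin d, (f (Pi.single i u) + f (Pi.single i (-u)))

/-- The rule is linear. [cite: DavisRabinowitz1984, Sect. 5.7 (5.7.5)] -/
theorem hypercubeRule3_finset_sum {L : Type*} (s : Finset L) (c : L → ℝ) (g : L → (Fin d → ℝ) → ℝ) (u : ℝ) :
    hypercubeRule3 d u (fun x => ∑ l ∈ s, c l * g l x) = ∑ l ∈ s, c l * hypercubeRule3 d u (g l) := by
  simp only [hypercubeRule3, ← Finset.sum_add_distrib, ← mul_add, Finset.mul_sum]
  rw [Finset.sum_comm]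
  refine Finset.sum_congr rfl fun l _ => ?_
  ring

/-- [folklore] A monomial at `± u e_i`: `∏_j (u e_i)_j^{e_j} = u^{e_i}` if `e` is supported in `{i}`, else `0`. -/
private theorem prod_single_pow (i : Fin d) (u : ℝ) (e : Fin d → ℕ) :
    ∏ j, (Pi.single i u : Fin d → ℝ) j ^ e j = if ∀ j ≠ i, e j = 0 then u ^ e i else 0 := by
  split_ifs with h
  · rw [Finset.prod_eq_single i (fun j _ hj => by rw [h j hj, pow_zero]) (by simp)]
    simp
  · simp only [not_forall, exists_prop] at h
    obtain ⟨j, hj, hej⟩ := h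
    exact Finset.prod_eq_zero (Finset.mem_univ j) (by rw [Pi.single_eq_of_ne hj, zero_pow hej])

/-- Exactness on monomials of degree `≤ 3` (5.7.5)–(5.7.8): for `d ≥ 1` and `u² = d/3`,
`∫_{H_d} x^e dV = hypercubeRule3 d u (x^e)` whenever `|e| ≤ 3`.
[cite: DavisRabinowitz1984, Sect. 5.7 (5.7.5)-(5.7.8)] -/
theorem integral_hypercube_monomial_eq_rule (hd : 0 < d) {u : ℝ} (hu : u ^ 2 = d / 3)
    (e : Fin d → ℕ) (he : ∑ i, e i ≤ 3) :
    ∫ x in hypercube d, ∏ i, x i ^ e i = hypercubeRule3 d u (fun x => ∏ i, x i ^ e i) := by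
  rw [integral_hypercube_monomial, hypercubeRule3]
  simp_rw [prod_single_pow]
  have hdR : (d : ℝ) ≠ 0 := by exact_mod_cast hd.ne'
  have h2 : (2 : ℝ) ^ (d - 1) = 2 ^ d / 2 := by
    rw [eq_div_iff two_ne_zero, ← pow_succ, Nat.sub_add_cancel hd]
  have hm0 : cubeMoment 0 = 2 := by norm_num [cubeMoment]
  have hm1 : cubeMoment 1 = 0 := by norm_num [cubeMoment]
  have hm2 : cubeMoment 2 = 2 / 3 := by norm_num [cubeMoment]
  have hm3 : cubeMoment 3 = 0 := by norm_num [cubeMoment]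
  rw [h2]
  by_cases h0 : e = 0
  · -- `f ≡ 1`: (5.7.6)
    subst h0
    simp only [Pi.zero_apply, pow_zero, ne_eq, implies_true, if_true, Finset.sum_const, Finset.card_univ,
      Fintype.card_fin, nsmul_eq_mul, hm0, Finset.prod_const]
    field_simp
    norm_num
  · obtain ⟨i₀, hi₀⟩ : ∃ i, e i ≠ 0 := by
      by_contra h
      simp only [not_exists, not_not] at h
      exact h0 (funext h)
    have hfail : ∀ i, i ≠ i₀ → ¬ ∀ j ≠ i, e j = 0 := fun i hi h => hi₀ (h i₀ (Ne.symm hi))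
    by_cases hsupp : ∀ j ≠ i₀, e j = 0
    · -- `e = k · δ_{i₀}` with `1 ≤ k ≤ 3`
      have hk3 : e i₀ ≤ 3 :=
        (Finset.single_le_sum (fun i _ => Nat.zero_le (e i)) (Finset.mem_univ i₀)).trans he
      rw [Finset.sum_eq_single i₀ (fun i _ hi => by rw [if_neg (hfail i hi), if_neg (hfail i hi), add_zero])
        (by simp), if_pos hsupp, if_pos hsupp,
        ← Finset.mul_prod_erase Finset.univ (fun i => cubeMoment (e i)) (Finset.mem_univ i₀),
        Finset.prod_congr rfl fun i hi => by rw [hsupp i (Finset.ne_of_mem_erase hi)], Finset.prod_const,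
        Finset.card_erase_of_mem (Finset.mem_univ _), Finset.card_univ, Fintype.card_fin, hm0, h2]
      have hk1 : 1 ≤ e i₀ := Nat.one_le_iff_ne_zero.2 hi₀
      generalize e i₀ = k at hk1 hk3
      interval_cases k
      · rw [hm1, zero_mul]
        ring
      · rw [hm2, neg_sq, hu]
        field_simp
        norm_num
      · rw [hm3, zero_mul]
        ring
    · -- at least two coordinates in the support: some exponent equals `1`
      simp only [not_forall, exists_prop] at hsupp
      obtain ⟨j₀, hj₀, hej₀⟩ := hsupp
      have hsum2 : e i₀ + e j₀ ≤ 3 := by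
        have := Finset.sum_le_sum_of_subset_of_nonneg (f := e)
          (Finset.subset_univ ({i₀, j₀} : Finset (Fin d))) (fun i _ _ => Nat.zero_le _)
        rw [Finset.sum_pair (Ne.symm hj₀)] at this
        exact this.trans he
      have hone : ∃ j, e j = 1 := by
        rcases Nat.lt_or_ge (e i₀) 2 with h | h
        · exact ⟨i₀, by omega⟩
        · exact ⟨j₀, by omega⟩
      obtain ⟨j, hj⟩ := hone
      rw [Finset.prod_eq_zero (Finset.mem_univ j) (by rw [hj, hm1]),
        Finset.sum_eq_zero fun i _ => ?_, mul_zero]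
      have : ¬ ∀ j ≠ i, e j = 0 := by
        by_cases hi : i = i₀
        · subst hi; exact fun h => hej₀ (h j₀ hj₀)
        · exact hfail i hi
      rw [if_neg this, if_neg this, add_zero]

/-- Exactness on polynomials of degree `≤ 3`, as finite combinations of monomials.
[cite: DavisRabinowitz1984, Sect. 5.7 (5.7.5)-(5.7.8)] -/
theorem integral_hypercube_sum_monomial_eq_rule (hd : 0 < d) {u : ℝ} (hu : u ^ 2 = d / 3)
    (s : Finset (Fin d → ℕ)) (c : (Fin d → ℕ) → ℝ) (hs : ∀ e ∈ s, ∑ i, e i ≤ 3) :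
    ∫ x in hypercube d, ∑ e ∈ s, c e * ∏ i, x i ^ e i =
      hypercubeRule3 d u (fun x => ∑ e ∈ s, c e * ∏ i, x i ^ e i) := by
  rw [hypercubeRule3_finset_sum, integral_finsetSum _ fun e he => ?_]
  · refine Finset.sum_congr rfl fun e he => ?_
    rw [integral_const_mul, integral_hypercube_monomial_eq_rule hd hu e (hs e he)]
  · refine Integrable.const_mul ?_ _
    refine ContinuousOn.integrableOn_compact (isCompact_univ_pi fun _ => isCompact_Icc) ?_
    exact (continuous_finsetProd _ fun i _ => (continuous_apply i).pow _).continuousOn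

/-- Precision exactly `3`: on `x_{i}^4` the rule is off by `2^d (1/5 - d/9)` (nonzero for every `d ≥ 1`).
[cite: DavisRabinowitz1984, Sect. 5.7 (5.7.8)] -/
theorem integral_hypercube_pow_four_sub_rule (hd : 0 < d) {u : ℝ} (hu : u ^ 2 = d / 3) (i₀ : Fin d) :
    (∫ x in hypercube d, x i₀ ^ 4) - hypercubeRule3 d u (fun x => x i₀ ^ 4) = 2 ^ d * (1 / 5 - d / 9) := by
  have hmono : ∀ x : Fin d → ℝ, x i₀ ^ 4 = ∏ i, x i ^ (Pi.single i₀ 4 : Fin d → ℕ) i := fun x => by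
    rw [Finset.prod_eq_single i₀ (fun j _ hj => by rw [Pi.single_eq_of_ne hj, pow_zero]) (by simp),
      Pi.single_eq_same]
  simp_rw [hmono]
  rw [integral_hypercube_monomial, hypercubeRule3]
  simp_rw [prod_single_pow]
  have hfail : ∀ i, i ≠ i₀ → ¬ ∀ j ≠ i, (Pi.single i₀ 4 : Fin d → ℕ) j = 0 := fun i hi h => by
    have := h i₀ (Ne.symm hi); simp at this
  have hsupp : ∀ j ≠ i₀, (Pi.single i₀ 4 : Fin d → ℕ) j = 0 := fun j hj => Pi.single_eq_of_ne hj _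
  have h2 : (2 : ℝ) ^ (d - 1) = 2 ^ d / 2 := by
    rw [eq_div_iff two_ne_zero, ← pow_succ, Nat.sub_add_cancel hd]
  have hdR : (d : ℝ) ≠ 0 := by exact_mod_cast hd.ne'
  have hm0 : cubeMoment 0 = 2 := by norm_num [cubeMoment]
  have hm4 : cubeMoment 4 = 2 / 5 := by norm_num [cubeMoment]
  rw [Finset.sum_eq_single i₀ (fun i _ hi => by rw [if_neg (hfail i hi), if_neg (hfail i hi), add_zero])
    (by simp), if_pos hsupp, if_pos hsupp,
    ← Finset.mul_prod_erase Finset.univ (fun i => cubeMoment ((Pi.single i₀ 4 : Fin d → ℕ) i))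
      (Finset.mem_univ i₀),
    Finset.prod_congr rfl fun i hi => by rw [hsupp i (Finset.ne_of_mem_erase hi)], Finset.prod_const,
    Finset.card_erase_of_mem (Finset.mem_univ _), Finset.card_univ, Fintype.card_fin]
  simp only [Pi.single_eq_same, hm0, hm4, h2]
  rw [show (-u) ^ 4 = (u ^ 2) ^ 2 by ring, show u ^ 4 = (u ^ 2) ^ 2 by ring, hu]
  field_simp
  ring

/-- The defect is nonzero: the rule has precision exactly `3`. [cite: DavisRabinowitz1984, Sect. 5.7 (5.7.8)] -/
theorem hypercubeRule3_not_exact_pow_four (hd : 0 < d) {u : ℝ} (hu : u ^ 2 = d / 3) (i₀ : Fin d) :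
    (∫ x in hypercube d, x i₀ ^ 4) ≠ hypercubeRule3 d u (fun x => x i₀ ^ 4) := by
  intro h
  have h' := integral_hypercube_pow_four_sub_rule hd hu i₀
  rw [h, sub_self] at h'
  have h9 : (1 : ℝ) / 5 - d / 9 ≠ 0 := by
    intro h0
    have : (9 : ℝ) = 5 * d := by linarith [h0]
    have h5 : (9 : ℕ) = 5 * d := by exact_mod_cast this
    omega
  exact (mul_ne_zero (pow_ne_zero _ two_ne_zero) h9) h'.symm

/-- `u = √(d/3)` satisfies `u² = d/3`, and `u > 1 ↔ d > 3` (the points leave the cube for `d > 3`).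
[cite: DavisRabinowitz1984, Sect. 5.7 (5.7.8)] -/
theorem sqrt_node_sq_and_gt_one (d : ℕ) :
    Real.sqrt (d / 3) ^ 2 = d / 3 ∧ (1 < Real.sqrt (d / 3) ↔ 3 < d) := by
  refine ⟨Real.sq_sqrt (by positivity), ?_⟩
  rw [Real.lt_sqrt zero_le_one, one_pow, lt_div_iff₀ (by norm_num : (0 : ℝ) < 3), one_mul]
  norm_cast

end

end Literature.Analysis.Quadrature
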